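import Literature.AnabelianGeometry.SemiGraphs.ProfiniteSemiGraphIsoInverse
import HarnessLib

/-!
# Isomorphisms over a base of profinite presentations are invertible (route T, TRANSPORT IV — corollary)

Mochizuki, *Semi-graphs of anabelioids*, Publ. RIMS **42** (2006), Def. 2.2 (ii) p. 24 (locally trivial
morphisms), Def. 3.5 (i) p. 37 (coverings read on profinite presentations; morphisms up to inner
automorphisms of the constituents) [cite: MochizukiSemiAnbd2006, Def 3.5(i) p.37].

abc-iut-L3-t3's `Hom.IsoOver p q` (`SgATemperedArrows.lean`) records an isomorphism `X → Y` of profinite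
presentations OVER a base `P` (compatible with the structure morphisms `p : X → P`, `q : Y → P` up to
inner automorphisms).  With the inverse morphism `Hom.inverse` of `ProfiniteSemiGraphIsoInverse.lean`
this file supplies the SYMMETRY `Hom.IsoOver.symm : Hom.IsoOver p q → Hom.IsoOver q p` (inverse
morphism, same base triangle, the vertex / edge compatibilities conjugated back and transported along
`F (F⁻¹ w) = w`).  Definition + bookkeeping (abc-iut cell, L3 route T · TRANSPORT; seat abc-iut-L3-d6);
nothing of the paper is asserted; nothing here bears on [IUTchIII] Cor. 3.12.
-/

noncomputable section

open CategoryTheory Topology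

namespace Literature.AnabelianGeometry.SemiGraphs

namespace ProfiniteSemiGraph

universe u

variable {X Y P : ProfiniteSemiGraph.{u}}

/-- Transport in the vertex groups of `P` along two successive equalities collapses (any two proofs of
the composite equality agree). [cite: MochizukiSemiAnbd2006, Def. 2.1 p.23] -/
theorem castGv_castGv_eq_castGv {w₁ w₂ w₃ : P.graph.Vertex} (h₁ : w₁ = w₂) (h₂ : w₂ = w₃) (h₃ : w₁ = w₃)
    (x : P.Gv w₁) : P.castGv h₂ (P.castGv h₁ x) = P.castGv h₃ x := by
  subst h₁; subst h₂; rfl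

/-- Transport in the edge groups of `P` along two successive equalities collapses.
[cite: MochizukiSemiAnbd2006, Def. 2.1 p.23] -/
theorem castGe_castGe_eq_castGe {e₁ e₂ e₃ : P.graph.Edge} (h₁ : e₁ = e₂) (h₂ : e₂ = e₃) (h₃ : e₁ = e₃)
    (x : P.Ge e₁) : P.castGe h₂ (P.castGe h₁ x) = P.castGe h₃ x := by
  subst h₁; subst h₂; rfl

namespace Hom.IsoOver

variable {p : Hom X P} {q : Hom Y P} (I : Hom.IsoOver p q)

/-- The base triangle of the inverse: `F⁻¹ ≫ p = q` on underlying semi-graphs.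
[cite: MochizukiSemiAnbd2006, Def 3.5(i) p.37] -/
theorem inv_base_comm :
    haveI := I.isIso_base
    (show Y.graph ⟶ X.graph from inv (C := SemiGraph.{u}) I.iso.base) ≫
      (show X.graph ⟶ P.graph from p.base) = q.base := by
  haveI := I.isIso_base
  rw [← I.base_comm, IsIso.inv_hom_id_assoc]

/-- `p (F⁻¹ w) = q w` on vertices. [cite: MochizukiSemiAnbd2006, Def 3.5(i) p.37] -/
theorem p_vertexMap_inv (w : Y.graph.Vertex) :
    haveI := I.isIso_base
    p.base.vertexMap ((inv (C := SemiGraph.{u}) I.iso.base).vertexMap w) = q.base.vertexMap w := by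
  haveI := I.isIso_base
  have h := congrArg (fun k : Y.graph ⟶ P.graph => k.vertexMap w) I.inv_base_comm
  exact h

/-- `p (F⁻¹ e) = q e` on edges. [cite: MochizukiSemiAnbd2006, Def 3.5(i) p.37] -/
theorem p_edgeMap_inv (e : Y.graph.Edge) :
    haveI := I.isIso_base
    p.base.edgeMap ((inv (C := SemiGraph.{u}) I.iso.base).edgeMap e) = q.base.edgeMap e := by
  haveI := I.isIso_base
  have h := congrArg (fun k : Y.graph ⟶ P.graph => k.edgeMap e) I.inv_base_comm
  exact h

/-- **Isomorphy over a base is symmetric**: the inverse morphism `F⁻¹ : Y → X` (`Hom.inverse`) is an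
isomorphism over `P` from `q` to `p`. [cite: MochizukiSemiAnbd2006, Def 3.5(i) p.37] -/
def symm : Hom.IsoOver q p := by
  haveI := I.isIso_base
  refine
    { iso := I.iso.inverse I.isLocallyTrivial
      isIso_base := Hom.isIso_inverse_base I.iso I.isLocallyTrivial
      isLocallyTrivial := I.iso.inverse_isLocallyTrivial I.isLocallyTrivial
      base_comm := I.inv_base_comm
      hV_comm := fun w => ?_
      hE_comm := fun e => ?_ }
  · -- vertices: conjugate `I.hV_comm` at `F⁻¹ w` back and transport along `F (F⁻¹ w) = w`
    obtain ⟨g₀, hg₀⟩ := I.hV_comm ((inv (C := SemiGraph.{u}) I.iso.base).vertexMap w)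
    have hw := SemiGraph.vertexMap_inv_vertexMap I.iso.base w
    refine ⟨P.castGv (I.p_vertexMap_inv w) g₀⁻¹, fun y => ?_⟩
    have h1 := hg₀ (I.iso.inverseHV I.isLocallyTrivial w y)
    rw [Hom.hV_inverseHV, q.hV_castGv hw.symm] at h1
    rw [castGv_castGv_eq_castGv _ _ (I.p_vertexMap_inv w).symm] at h1
    -- `h1 : castGv _ (q_w y) = g₀ * p (F⁻¹ w) ((F⁻¹)_w y) * g₀⁻¹`
    have h2 : p.hV _ (I.iso.inverseHV I.isLocallyTrivial w y) =
        g₀⁻¹ * P.castGv (I.p_vertexMap_inv w).symm (q.hV w y) * g₀ := by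
      rw [h1]; group
    change P.castGv (I.p_vertexMap_inv w) (p.hV _ (I.iso.inverseHV I.isLocallyTrivial w y)) = _
    rw [h2, map_mul, map_mul, castGv_castGv_eq_castGv _ _ rfl, castGv_rfl, map_inv, inv_inv]
  · obtain ⟨g₀, hg₀⟩ := I.hE_comm ((inv (C := SemiGraph.{u}) I.iso.base).edgeMap e)
    have he := SemiGraph.edgeMap_inv_edgeMap I.iso.base e
    refine ⟨P.castGe (I.p_edgeMap_inv e) g₀⁻¹, fun y => ?_⟩
    have h1 := hg₀ (I.iso.inverseHE I.isLocallyTrivial e y)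
    rw [Hom.hE_inverseHE, q.hE_castGe he.symm] at h1
    rw [castGe_castGe_eq_castGe _ _ (I.p_edgeMap_inv e).symm] at h1
    have h2 : p.hE _ (I.iso.inverseHE I.isLocallyTrivial e y) =
        g₀⁻¹ * P.castGe (I.p_edgeMap_inv e).symm (q.hE e y) * g₀ := by
      rw [h1]; group
    change P.castGe (I.p_edgeMap_inv e) (p.hE _ (I.iso.inverseHE I.isLocallyTrivial e y)) = _
    rw [h2, map_mul, map_mul, castGe_castGe_eq_castGe _ _ rfl, castGe_rfl, map_inv, inv_inv]

/-- The comparison morphism of the symmetric isomorphism is the inverse morphism (definitional).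
[cite: MochizukiSemiAnbd2006, Def 3.5(i) p.37] -/
theorem symm_iso :
    haveI := I.isIso_base
    I.symm.iso = I.iso.inverse I.isLocallyTrivial := rfl

end Hom.IsoOver

end ProfiniteSemiGraph

end Literature.AnabelianGeometry.SemiGraphs

end
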